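import Literature.Analysis.OperatorTheory.Enflo2023.StepRealisationScale
import HarnessLib

/-!
# Enflo (2023), v2 pp.16–20: the reachability class of the run-level residual is a LEVEL SET; the ORBIT form
`IndepRunD` of the located Part-B gap

P. H. Enflo, *On the invariant subspace problem in Hilbert spaces*, arXiv:2305.15442v2 (2023) — a CLAIMED result
under adjudication; nothing in this file asserts the manuscript's theorem.

`StepRealisationScale` packages what Part B (pp.16–20) uses and never derives as ONE hypothesis: the two-fold
first-order independence (34), each functional at its own scale, with one modulus `σ`, asked at every state of the
reachability class `MCStep.ReachN (22/σ) β (RadInv σ s₀) s₀` in the epoch invariant of a reachable pivot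
(`IndepRunκ`; `isp_of_partBResidualIndepκ`).  This file makes two things precise.

## A. `ReachN` is decided by three scalars (§A)
At a true MC state `Re⟨x₀, v⟩ = ε² + (εθ)` (`‖v‖ = ε` by (1), `Re⟨x₀ − v, v⟩ = (εθ)` by (16); `ClaimAudit`'s
`State.re_inner_x₀_v`), so the drift (45) of a step `s → s'` is `|(ε'² − ε²) + ((εθ)' − (εθ))|`
(`State.re_inner_x₀_sub_v`) and the step relation of `ReachN C β N s₀` reads on `(N, ε, εθ)` alone
(`ReachN.iff_scalars`).  Consequences: a state sharing radius and `(εθ)` with a state reached by a step is itself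
"reachable" (`ReachN.of_same_scalars`); from any reachable `s`, EVERY `N`-state of the same radius with
`(1 − Cβ)(εθ)_s ≤ (εθ)' ≤ (1 − β)(εθ)_s` is reachable in one step (`ReachN.of_band`).  Hence `IndepRunκ … s₀`
asserts (34) (self-pivot form, `InvP C s (x₀ − v_s) s` being trivial) at every same-radius state in such a band
(`indepAtκ_of_indepRunκ_of_band`): a statement about LEVEL SETS of `(ε, εθ)`, uniformly over the coefficient
vector — whereas the text asks δ₂-independence "for a sequence of n's" along the run it builds (v2 p.19
l.667–670, p.20 l.675–677).  (The `pub-enflo` referee record, §30, noted the over-approximation qualitatively; this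
is its exact extent.)

## B. The orbit form of the residual (§§B–C)
`ReachD ι σ β s₀` is the class of states the realised construction can actually visit from `s₀`: closure of `{s₀}`
under the steps `exists_state_stepκ` produces — coefficient operator `W_s(1 + ι p)` with `‖p‖ ≤ 2β/σ` over the
commutant ("`y_{n+1} = (1+N)y_n`", (41)–(44) p.18–19), EXACT ratio `(εθ)' = (1−β)(εθ)` ((b′)), drift
`|Re⟨x₀, v' − v⟩| ≤ (22/σ)β(εθ)` ((45)) and `|ε'² − ε²| ≤ (22/σ + 1)β(εθ)`.  Along it `(εθ) = (1−β)ⁿ(εθ)₀` exactly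
(`ReachD.etheta_eq_pow`), the radius invariant holds (`ReachD.radInv`), `ReachD ⊆ ReachN …` (`ReachD.reachN`), and
the coefficient operators stay in `ℂ·V₀∘{S}'` (`ReachD.exists_comm`).  `IndepRunD` asks (34) only there; it is
implied by `IndepRunκ` (`indepRunD_of_indepRunκ`) and still suffices: `claimG_of_indepRunD` (the restricted step
claim `ClaimG` on the orbit class), `nis_of_indepRunD`, and the packaged residual
`PartBResidualIndepD → Referee.ISP_separable` (`isp_of_partBResidualIndepD`; `partBResidualIndepD_of_indepκ`).
This is the weakest packaging of the located gap the route reaches: (34) two-fold intrinsic, one modulus, AT THE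
STATES THE CONSTRUCTION VISITS.  The finite-dimensional calibrations (`StepRealisationToy`, `StepRealisationDiag`)
refute this orbit form too — their proofs only ever query self-pivots along commutant steps
(`StepRealisationOrbitModels`).

What is NOT a theorem here: `IndepRunD` (or `IndepRunκ`) for any operator without invariant subspaces; see
`pub-enflo/GAP.md` §"Formaliser 2, generation 15".
-/

noncomputable section

open scoped InnerProductSpace ComplexConjugate NNReal
open ContinuousLinearMap RCLike Metric Set

namespace Literature.Analysis.OperatorTheory.Enflo2023

namespace StepRealisation

open MCStep

variable {E H : Type*} [NormedAddCommGroup E] [InnerProductSpace ℂ E] [CompleteSpace E]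
  [NormedAddCommGroup H] [InnerProductSpace ℂ H] [CompleteSpace H]

/-! ### A. The reachability class is decided by `(N, ε, εθ)` -/

section Scalars

variable {T : H →L[ℂ] H} {x₀ : H} {S : E →L[ℂ] E}

/-- (1) + (16): the drift (45) of a step is a difference of SCALARS,
`Re⟨x₀, v' − v⟩ = (ε'² − ε²) + ((εθ)' − (εθ))` (`Re⟨x₀, v⟩ = ‖v‖² + (εθ)`, `State.re_inner_x₀_v`, and `‖v‖ = ε`).
[cite: Enflo2023, v2 (1) p.2, (16) p.6, (45) p.19] -/
lemma _root_.Literature.Analysis.OperatorTheory.Enflo2023.MCStep.State.re_inner_x₀_sub_v (s s' : State T x₀ S)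
    (hx₀ : ‖x₀‖ = 1) : re ⟪x₀, s'.v - s.v⟫_ℂ = (s'.ε ^ 2 - s.ε ^ 2) + (s'.etheta - s.etheta) := by
  rw [inner_sub_right, map_sub, RCLike.re_to_complex, RCLike.re_to_complex, s'.re_inner_x₀_v hx₀,
    s.re_inner_x₀_v hx₀, s'.norm_v hx₀, s.norm_v hx₀]
  ring

variable {C β : ℝ} {N : State T x₀ S → Prop} {s₀ s s' : State T x₀ S}

/-- **`ReachN` is decided by three scalars**: `s'` is reachable iff it is the start or some reachable `s` steps to
it, the step conditions reading on `(N s', ε', (εθ)')` and `(ε, (εθ))` only. [cite: Enflo2023, v2 (b′) p.17, (45) p.19] -/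
theorem _root_.Literature.Analysis.OperatorTheory.Enflo2023.MCStep.ReachN.iff_scalars (hx₀ : ‖x₀‖ = 1) :
    ReachN C β N s₀ s' ↔ s' = s₀ ∨ ∃ s : State T x₀ S, ReachN C β N s₀ s ∧ N s' ∧
      s'.etheta ≤ (1 - β) * s.etheta ∧
      |(s'.ε ^ 2 - s.ε ^ 2) + (s'.etheta - s.etheta)| ≤ C * β * s.etheta := by
  constructor
  · intro h
    cases h with
    | start => exact Or.inl rfl
    | step hs hN h1 h3 => exact Or.inr ⟨_, hs, hN, h1, by rwa [State.re_inner_x₀_sub_v _ _ hx₀] at h3⟩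
  · rintro (rfl | ⟨s, hs, hN, h1, h3⟩)
    · exact ReachN.start
    · exact ReachN.step hs hN h1 (by rwa [State.re_inner_x₀_sub_v _ _ hx₀])

/-- **Level sets**: a state with the invariant sharing radius and `(εθ)` with a state reached by a step (any
reachable state below the start level) is reachable — whatever its coefficient vector. [folklore] -/
theorem _root_.Literature.Analysis.OperatorTheory.Enflo2023.MCStep.ReachN.of_same_scalars (hx₀ : ‖x₀‖ = 1)
    (h : ReachN C β N s₀ s) (hlt : s.etheta < s₀.etheta) (hN : N s') (hε : s'.ε = s.ε)
    (he : s'.etheta = s.etheta) : ReachN C β N s₀ s' := by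
  cases h with
  | start => exact absurd hlt (lt_irrefl _)
  | step ht hNs h1 h3 =>
    refine ReachN.step ht hN (he ▸ h1) ?_
    rw [State.re_inner_x₀_sub_v _ _ hx₀] at h3 ⊢
    rw [hε, he]; exact h3

/-- **Bands**: from a reachable `s`, every `N`-state of the SAME radius with
`(1 − Cβ)(εθ)_s ≤ (εθ)' ≤ (1 − β)(εθ)_s` is reachable in one step (`0 ≤ C`, `0 ≤ β`). [folklore] -/
theorem _root_.Literature.Analysis.OperatorTheory.Enflo2023.MCStep.ReachN.of_band (hx₀ : ‖x₀‖ = 1)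
    (hS : ‖S‖ ≤ 1) (hC : 0 ≤ C) (hβ : 0 ≤ β) (h : ReachN C β N s₀ s) (hN : N s') (hε : s'.ε = s.ε)
    (hlo : (1 - C * β) * s.etheta ≤ s'.etheta) (hhi : s'.etheta ≤ (1 - β) * s.etheta) :
    ReachN C β N s₀ s' := by
  refine ReachN.step h hN hhi ?_
  rw [s.re_inner_x₀_sub_v s' hx₀, hε, sub_self, zero_add]
  have he : 0 ≤ s.etheta := s.etheta_nonneg hx₀ hS
  have h1 : 0 ≤ C * β * s.etheta := by positivity
  have h2 : 0 ≤ β * s.etheta := by positivity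
  rw [abs_le]; constructor <;> nlinarith

end Scalars

section ScalarsRun

variable {T : H →L[ℂ] H} {x₀ : H} {S : E →L[ℂ] E}
variable {P : Type*} [NormedAddCommGroup P] [NormedSpace ℝ P]

omit [NormedSpace ℝ P] in
/-- **What `IndepRunκ` asks on level sets**: (34) (two-fold, intrinsic, modulus `σ`, self-pivot form) at EVERY true
MC state of the same radius as a reachable `s` whose `(εθ)` lies in the band
`[(1 − (22/σ)β)(εθ)_s, (1 − β)(εθ)_s]` — uniformly over the coefficient vector, not only at the state the step
produces ("for a sequence of n's", v2 p.19 l.667–670, is what the text asks). [cite: Enflo2023, v2 (34) p.16; p.19–20] -/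
theorem indepAtκ_of_indepRunκ_of_band {ι : P →+ (E →L[ℂ] E)} {σ β : ℝ} {s₀ : State T x₀ S} (hx₀ : ‖x₀‖ = 1)
    (hS : ‖S‖ ≤ 1) (hσ : 0 < σ) (hβ : 0 ≤ β) (h : IndepRunκ T x₀ S ι σ β s₀) {s s' : State T x₀ S}
    (hs : ReachN (22 / σ) β (RadInv σ s₀) s₀ s) (hε : s'.ε = s.ε)
    (hlo : (1 - 22 / σ * β) * s.etheta ≤ s'.etheta) (hhi : s'.etheta ≤ (1 - β) * s.etheta)
    (he : 0 < s'.etheta) : IndepAtκ ι σ s' (x₀ - s'.v) := by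
  have hC : (0 : ℝ) ≤ 22 / σ := by positivity
  have hR0 : RadInv σ s₀ s₀ := by
    show |s₀.ε ^ 2 - s₀.ε ^ 2| ≤ (22 / σ + 1) * (s₀.etheta - s₀.etheta)
    rw [sub_self, abs_zero, sub_self, mul_zero]
  have hRs : RadInv σ s₀ s := hs.inv hR0
  have hes : 0 ≤ s.etheta := s.etheta_nonneg hx₀ hS
  have hle : s'.etheta ≤ s.etheta := hhi.trans (by nlinarith)
  have hR' : RadInv σ s₀ s' := by
    show |s'.ε ^ 2 - s₀.ε ^ 2| ≤ (22 / σ + 1) * (s₀.etheta - s'.etheta)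
    have h1 : |s.ε ^ 2 - s₀.ε ^ 2| ≤ (22 / σ + 1) * (s₀.etheta - s.etheta) := hRs
    have h2 : (22 / σ + 1) * (s₀.etheta - s.etheta) ≤ (22 / σ + 1) * (s₀.etheta - s'.etheta) :=
      mul_le_mul_of_nonneg_left (by linarith) (by positivity)
    rw [hε]; exact h1.trans h2
  have hs' : ReachN (22 / σ) β (RadInv σ s₀) s₀ s' := hs.of_band hx₀ hS hC hβ hR' hε hlo hhi
  exact h s' s' hs' hs' (invP_self' _ s' _) he

end ScalarsRun

/-! ### B. The orbit class `ReachD` of the realised construction -/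

section Orbit

variable {T : H →L[ℂ] H} {x₀ : H} {S : E →L[ℂ] E}
variable {P : Type*} [NormedAddCommGroup P] [NormedSpace ℝ P]

/-- **The states the realised construction visits from `s₀`**: `s₀`, and from a visited `s` with `(εθ)_s > 0` any
true MC state `s'` whose coefficient operator is `W_s(1 + ι p)` with `‖p‖ ≤ 2β/σ` ((41)–(44): `y' = (1+N)y` over the
commutant) and which has EXACTLY `(εθ)' = (1−β)(εθ)_s` ((b′)), the drift (45) `|Re⟨x₀, v' − v⟩| ≤ (22/σ)β(εθ)_s` and
`|ε'² − ε²| ≤ (22/σ + 1)β(εθ)_s` — precisely the output of `exists_state_stepκ`. [cite: Enflo2023, v2 (41)–(46) p.18–19, (b′) p.17] -/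
inductive ReachD (ι : P →+ (E →L[ℂ] E)) (σ β : ℝ) (s₀ : State T x₀ S) : State T x₀ S → Prop
  | start : ReachD ι σ β s₀ s₀
  | step {s s' : State T x₀ S} : ReachD ι σ β s₀ s → 0 < s.etheta →
      (∃ p : P, ‖p‖ ≤ 2 * β / σ ∧ s'.V = Wn s ∘L (1 + ι p)) → s'.etheta = (1 - β) * s.etheta →
      |(⟪x₀, s'.v - s.v⟫_ℂ).re| ≤ 22 / σ * β * s.etheta → |s'.ε ^ 2 - s.ε ^ 2| ≤ (22 / σ + 1) * β * s.etheta →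
      ReachD ι σ β s₀ s'

namespace ReachD

variable {ι : P →+ (E →L[ℂ] E)} {σ β : ℝ} {s₀ s : State T x₀ S}

omit [NormedSpace ℝ P] [CompleteSpace E] [CompleteSpace H] in
/-- Along the orbit `(εθ) = (1−β)ⁿ(εθ)₀` EXACTLY. [cite: Enflo2023, v2 (b′) p.17] -/
theorem etheta_eq_pow (h : ReachD ι σ β s₀ s) : ∃ n : ℕ, s.etheta = (1 - β) ^ n * s₀.etheta := by
  induction h with
  | start => exact ⟨0, by rw [pow_zero, one_mul]⟩
  | step _ _ _ h1 _ _ ih =>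
    obtain ⟨n, hn⟩ := ih
    exact ⟨n + 1, by rw [h1, hn, pow_succ]; ring⟩

omit [NormedSpace ℝ P] [CompleteSpace E] [CompleteSpace H] in
/-- Along the orbit `(εθ)` does not increase (`0 ≤ β ≤ 1`, `(εθ)₀ ≥ 0`). [cite: Enflo2023, v2 (b′) p.17] -/
theorem etheta_le (hβ0 : 0 ≤ β) (hβ1 : β ≤ 1) (he0 : 0 ≤ s₀.etheta) (h : ReachD ι σ β s₀ s) :
    s.etheta ≤ s₀.etheta := by
  obtain ⟨n, hn⟩ := h.etheta_eq_pow
  rw [hn]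
  exact mul_le_of_le_one_left he0 (pow_le_one₀ (by linarith) (by linarith))

omit [NormedSpace ℝ P] [CompleteSpace E] [CompleteSpace H] in
/-- Along the orbit `(εθ) ≥ 0` as soon as `(εθ)₀ ≥ 0` and `β ≤ 1`. [folklore] -/
theorem etheta_nonneg' (hβ1 : β ≤ 1) (he0 : 0 ≤ s₀.etheta) (h : ReachD ι σ β s₀ s) : 0 ≤ s.etheta := by
  obtain ⟨n, hn⟩ := h.etheta_eq_pow
  rw [hn]; exact mul_nonneg (pow_nonneg (by linarith) _) he0

omit [NormedSpace ℝ P] [CompleteSpace E] [CompleteSpace H] in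
/-- **The radius invariant holds along the orbit**: `|ε² − ε₀²| ≤ (22/σ + 1)((εθ)₀ − (εθ))` ((33) maintained by
(45) summed). [cite: Enflo2023, v2 (33) p.15, (45) p.19] -/
theorem radInv (h : ReachD ι σ β s₀ s) : RadInv σ s₀ s := by
  induction h with
  | start =>
    show |s₀.ε ^ 2 - s₀.ε ^ 2| ≤ (22 / σ + 1) * (s₀.etheta - s₀.etheta)
    rw [sub_self, abs_zero, sub_self, mul_zero]
  | @step t t' _ _ _ h1 _ h4 ih =>
    have ih' : |t.ε ^ 2 - s₀.ε ^ 2| ≤ (22 / σ + 1) * (s₀.etheta - t.etheta) := ih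
    show |t'.ε ^ 2 - s₀.ε ^ 2| ≤ (22 / σ + 1) * (s₀.etheta - t'.etheta)
    calc |t'.ε ^ 2 - s₀.ε ^ 2| ≤ |t'.ε ^ 2 - t.ε ^ 2| + |t.ε ^ 2 - s₀.ε ^ 2| := abs_sub_le _ _ _
      _ ≤ (22 / σ + 1) * β * t.etheta + (22 / σ + 1) * (s₀.etheta - t.etheta) := add_le_add h4 ih'
      _ = (22 / σ + 1) * (s₀.etheta - t'.etheta) := by rw [h1]; ring

omit [NormedSpace ℝ P] [CompleteSpace E] [CompleteSpace H] in
/-- **The orbit lies inside the reachability class** `ReachN (22/σ) β (RadInv σ s₀) s₀`. [folklore] -/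
theorem reachN (h : ReachD ι σ β s₀ s) : ReachN (22 / σ) β (RadInv σ s₀) s₀ s := by
  induction h with
  | start => exact ReachN.start
  | step hs he hp h1 h3 h4 ih =>
    refine ReachN.step ih ((hs.step he hp h1 h3 h4).radInv) h1.le ?_
    rw [RCLike.re_to_complex]; exact h3

omit [NormedSpace ℝ P] [CompleteSpace E] [CompleteSpace H] in
/-- **The orbit's coefficient operators stay in `ℝ₊·V₀∘{S}'`**: `V_s = c·V₀∘A` with `A` in the closure of
`{1 + ι p}` under products, so commuting with `S` when every `ι p` does ("`y' = (1 + N)y`", (41) p.18).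
[cite: Enflo2023, v2 (41)–(44) p.18–19] -/
theorem exists_comm (hιS : ∀ p, ι p ∘L S = S ∘L ι p) (h : ReachD ι σ β s₀ s) :
    ∃ (c : ℝ) (A : E →L[ℂ] E), A ∘L S = S ∘L A ∧ s.V = ((c : ℝ) : ℂ) • (s₀.V ∘L A) := by
  induction h with
  | start =>
    refine ⟨1, 1, ?_, ?_⟩
    · rw [one_def, id_comp, comp_id]
    · rw [one_def, comp_id, Complex.ofReal_one, one_smul]
  | @step t t' _ _ hp _ _ _ ih =>
    obtain ⟨c, A, hA, hV⟩ := ih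
    obtain ⟨p, -, hV'⟩ := hp
    have h1S : (1 + ι p) ∘L S = S ∘L (1 + ι p) := by
      rw [add_comp, comp_add, hιS p, one_def, id_comp, comp_id]
    refine ⟨Real.sqrt (‖t.a‖ ^ 2 / t.etheta) * c, A ∘L (1 + ι p), ?_, ?_⟩
    · calc (A ∘L (1 + ι p)) ∘L S = A ∘L ((1 + ι p) ∘L S) := comp_assoc _ _ _
        _ = A ∘L (S ∘L (1 + ι p)) := by rw [h1S]
        _ = (A ∘L S) ∘L (1 + ι p) := (comp_assoc _ _ _).symm
        _ = (S ∘L A) ∘L (1 + ι p) := by rw [hA]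
        _ = S ∘L (A ∘L (1 + ι p)) := comp_assoc _ _ _
    · rw [hV', Wn, hV, Complex.ofReal_mul, smul_comp, smul_comp, smul_smul, comp_assoc]

end ReachD

/-! ### C. The orbit form `IndepRunD` of the residual, and its sufficiency -/

/-- THE RUN-LEVEL HYPOTHESIS, ORBIT FORM — the weakest residual this route reaches: the two-fold first-order
independence (34) `IndepAtκ ι σ s c` (each functional at its own scale) with ONE modulus `σ`, at every state `s`
with `(εθ)_s > 0` THAT THE CONSTRUCTION VISITS from `s₀` (`ReachD`: commutant steps `W(1 + ι p)`, `‖p‖ ≤ 2β/σ`,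
exact ratio `1 − β`) and lies in the epoch invariant of a visited pivot `P`, for `c = x₀ − v_P`.  This is (34) p.16
together with "δ₂-linearly independent … for a sequence of n's, n ≥ n₀'" / "we can assume that for all n, yₙ will
be δ₂-linearly independent" (v2 p.19 l.667–670, p.20 l.675–677) — asserted in the text, never derived.
[cite: Enflo2023, v2 (34) p.16; p.19–20] -/
def IndepRunD (T : H →L[ℂ] H) (x₀ : H) (S : E →L[ℂ] E) (ι : P →+ (E →L[ℂ] E)) (σ β : ℝ)
    (s₀ : State T x₀ S) : Prop :=
  ∀ Pv s : State T x₀ S, ReachD ι σ β s₀ Pv → ReachD ι σ β s₀ s →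
    InvP (22 / σ) Pv (x₀ - Pv.v) s → 0 < s.etheta → IndepAtκ ι σ s (x₀ - Pv.v)

omit [NormedSpace ℝ P] in
/-- The level-set form implies the orbit form (`ReachD ⊆ ReachN`). [folklore] -/
theorem indepRunD_of_indepRunκ {ι : P →+ (E →L[ℂ] E)} {σ β : ℝ} {s₀ : State T x₀ S}
    (h : IndepRunκ T x₀ S ι σ β s₀) : IndepRunD T x₀ S ι σ β s₀ :=
  fun Pv s hP hs hinv he => h Pv s hP.reachN hs.reachN hinv he

/-- **Orbit-level independence ⟹ the step claim restricted to the orbit class** (`C = 22/σ`, `G ≥ 0` arbitrary),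
given the start margin `(22/σ + 1)(εθ)₀`: every step the endgame takes from a visited state lands in a visited
state. [cite: Enflo2023, v2 (32), (34)–(46), p.15–19; p.19–20] -/
theorem claimG_of_indepRunD [CompleteSpace P] {ι : P →+ (E →L[ℂ] E)} (hx₀ : ‖x₀‖ = 1) (hS : ‖S‖ ≤ 1)
    (hιs : ∀ (t : ℝ) (p : P), ι (t • p) = (t : ℂ) • ι p) (hι1 : ∀ p, ‖ι p‖ ≤ ‖p‖)
    (hιS : ∀ p, ι p ∘L S = S ∘L ι p) {σ β : ℝ} (hσ : 0 < σ) (hσ1 : σ ≤ 1) (hβ0 : 0 ≤ β)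
    (hβ : β ≤ σ ^ 2 / 1000) (G : ℝ → ℝ) (hG0 : ∀ x, 0 ≤ G x) (s₀ : State T x₀ S)
    (hstart : (0.09 : ℝ) + (22 / σ + 1) * s₀.etheta ≤ s₀.ε ^ 2 ∧
      s₀.ε ^ 2 + (22 / σ + 1) * s₀.etheta ≤ 0.49)
    (h : IndepRunD T x₀ S ι σ β s₀) : ClaimG T x₀ S (22 / σ) β G (ReachD ι σ β s₀) := by
  have hσ2 : σ ^ 2 ≤ σ := by nlinarith
  have hβ1 : β ≤ 1 := by linarith
  intro Pv hPv
  refine ⟨x₀ - Pv.v, x₀_sub_v_ne_zero hx₀ Pv, ?_, fun s hs hinv => ?_⟩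
  · rw [sub_self, norm_zero]
    exact mul_nonneg (hG0 _) (by positivity)
  · set K : ℝ := 22 / σ + 1 with hK
    have hK0 : 0 ≤ K := by positivity
    have hRs : |s.ε ^ 2 - s₀.ε ^ 2| ≤ K * (s₀.etheta - s.etheta) := hs.radInv
    have he0 : 0 ≤ s.etheta := s.etheta_nonneg hx₀ hS
    rcases he0.eq_or_lt with he | he
    · refine ⟨s, hs, ?_, ?_, ?_⟩
      · rw [← he]; simp
      · rw [sub_self, inner_zero_right]
      · rw [sub_self, inner_zero_right, map_zero, abs_zero, ← he]; simp
    · have hβe : K * β * s.etheta ≤ K * s.etheta := by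
        have h1 : β * s.etheta ≤ s.etheta := mul_le_of_le_one_left he0 hβ1
        have h2 := mul_le_mul_of_nonneg_left h1 hK0
        linarith [h2]
      have hab := abs_le.1 hRs
      have hlo : (0.09 : ℝ) + (22 / σ + 1) * β * s.etheta ≤ s.ε ^ 2 := by
        rw [← hK]; linarith [hab.1, hstart.1]
      have hhi : s.ε ^ 2 + (22 / σ + 1) * β * s.etheta ≤ 0.49 := by
        rw [← hK]; linarith [hab.2, hstart.2]
      obtain ⟨s', h1, h2, h3, h4, p, hp, hV'⟩ := exists_state_stepκ hιs hι1 hιS hx₀ s he hσ hσ1 hβ0 hβ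
        (x₀ - Pv.v) (h Pv s hPv hs hinv he) hlo hhi
      refine ⟨s', hs.step he ⟨p, hp, hV'⟩ h1 h3 h4, h1.le, h2, ?_⟩
      rw [RCLike.re_to_complex]
      exact h3

/-- **Orbit-level independence ⟹ a non-trivial closed invariant subspace** (`β := σ²/1000`).
[cite: Enflo2023, v2 (34)–(47), p.16–20; p.22 (11)] -/
theorem nis_of_indepRunD [CompleteSpace P] (T : H →L[ℂ] H) (x₀ : H) (hx₀ : ‖x₀‖ = 1) (S : E →L[ℂ] E)
    (hS : ‖S‖ ≤ 1) {ι : P →+ (E →L[ℂ] E)} (hιs : ∀ (t : ℝ) (p : P), ι (t • p) = (t : ℂ) • ι p)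
    (hι1 : ∀ p, ‖ι p‖ ≤ ‖p‖) (hιS : ∀ p, ι p ∘L S = S ∘L ι p) {σ : ℝ} (hσ : 0 < σ) (hσ1 : σ ≤ 1)
    (s₀ : State T x₀ S)
    (hstart : (0.09 : ℝ) + (22 / σ + 1) * s₀.etheta ≤ s₀.ε ^ 2 ∧
      s₀.ε ^ 2 + (22 / σ + 1) * s₀.etheta ≤ 0.49)
    (h : IndepRunD T x₀ S ι σ (σ ^ 2 / 1000) s₀) :
    HasNontrivialClosedInvariantSubspace T := by
  have hβ : 0 < σ ^ 2 / 1000 := by positivity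
  have hσ2 : σ ^ 2 ≤ 1 := pow_le_one₀ hσ.le hσ1
  have hβ1 : σ ^ 2 / 1000 ≤ 1 := by linarith
  have hC : (0 : ℝ) ≤ 22 / σ := by positivity
  exact nis_of_claimG T x₀ hx₀ S hS hC hβ hβ1 (fun _ => 0) (fun _ => le_rfl)
    (fun η hη => ⟨1, one_pos, fun _ _ _ => hη.le⟩)
    (claimG_of_indepRunD hx₀ hS hιs hι1 hιS hσ hσ1 hβ.le le_rfl (fun _ => 0) (fun _ => le_rfl) s₀ hstart h)
    s₀ ReachD.start

/-- **THE PACKAGED RESIDUAL OF PART B, ORBIT FORM** — a HYPOTHESIS, never a theorem: for every operator of the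
reduced class (`‖T‖ = 10⁻²⁰`, `H` separable infinite-dimensional) EITHER a non-trivial closed invariant subspace is
at hand, OR there are a unit vector `x₀`, a true MC state `s₀` over the shift of `ℓ²` whose radius has the margin
`(22/σ + 1)(εθ)₀`, and a constant `0 < σ ≤ 1` such that the two-fold first-order independence (34), each functional
at its own scale, holds with modulus `σ` at the states the construction visits from `s₀` over the commutant of the
shift (`IndepRunD`).  This is (34) + "for a sequence of n's … we can assume that for all n … δ₂-linearly
independent" (v2 p.16, p.19–20) and nothing else of pp.16–20. [cite: Enflo2023, v2 (34) p.16, p.19–20; §Theorem p.20–22] -/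
@[claim "Enflo2023" "disputed"]
def PartBResidualIndepD : Prop :=
  ∀ (H : Type) [NormedAddCommGroup H] [InnerProductSpace ℂ H] [CompleteSpace H]
    [TopologicalSpace.SeparableSpace H], ¬ FiniteDimensional ℂ H →
    ∀ (T : H →L[ℂ] H), ‖T‖ < 1 → ‖T‖ = 1e-20 →
      HasNontrivialClosedInvariantSubspace T ∨
      ∃ (x₀ : H) (s₀ : State T x₀ Vy.S) (σ : ℝ), ‖x₀‖ = 1 ∧ 0 < σ ∧ σ ≤ 1 ∧
        ((0.09 : ℝ) + (22 / σ + 1) * s₀.etheta ≤ s₀.ε ^ 2 ∧ s₀.ε ^ 2 + (22 / σ + 1) * s₀.etheta ≤ 0.49) ∧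
        IndepRunD T x₀ Vy.S (ιS Vy.S) σ (σ ^ 2 / 1000) s₀

/-- **The implication that IS a theorem (orbit form)**: `PartBResidualIndepD → ISP_separable`.
[cite: Enflo2023, v2 §Theorem p.20–22; (34) p.16] -/
theorem isp_of_partBResidualIndepD (hR : PartBResidualIndepD) : Referee.ISP_separable := by
  intro H _ _ _ _ hH T
  by_cases hT0 : T = 0
  · rw [hT0]; exact EndToEnd.nis_zero hH
  · obtain ⟨hnorm, hiff⟩ := wlog_opNorm T hT0
    set T' : H →L[ℂ] H := (((1e-20 : ℝ) / ‖T‖ : ℝ) : ℂ) • T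
    have hT1 : ‖T'‖ < 1 := by rw [hnorm]; norm_num
    rcases hR H hH T' hT1 hnorm with hinv | ⟨x₀, s₀, σ, hx₀, hσ, hσ1, hstart, hrun⟩
    · exact hiff.1 hinv
    · obtain ⟨hιs, hι1, hιS⟩ := ιS_props (Vy.S)
      exact hiff.1 (nis_of_indepRunD T' x₀ hx₀ Vy.S Vy.norm_S_le hιs hι1 hιS hσ hσ1 s₀ hstart hrun)

/-- The level-set packaged residual implies the orbit one (pointwise in the witness). [folklore] -/
theorem partBResidualIndepD_of_indepκ (hR : PartBResidualIndepκ) : PartBResidualIndepD := by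
  intro H _ _ _ _ hH T hT1 hnorm
  rcases hR H hH T hT1 hnorm with hinv | ⟨x₀, s₀, σ, hx₀, hσ, hσ1, hstart, hrun⟩
  · exact Or.inl hinv
  · exact Or.inr ⟨x₀, s₀, σ, hx₀, hσ, hσ1, hstart, indepRunD_of_indepRunκ hrun⟩

end Orbit

end StepRealisation

end Literature.Analysis.OperatorTheory.Enflo2023

end
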